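import Literature.Algebra.Module.PairedTorsionModulesDVR
import Literature.GroupTheory.FiniteAbelian.AlternatingPairing
import HarnessLib

/-!
# Alternating pairings with prescribed kernel give even socle layers (Howard 2004, proof of Thm. 1.4.2),
# and the parity `ε ≡ dim N[ϖ] (mod 2)` of `N ≅ (R/ϖᵏ)^ε ⊕ M ⊕ M` (Howard 2004, Prop. 1.5.5)

Topic `Algebra/Module`; namespace `Literature.Algebra.Module`. THEOREMS ONLY: no definition, no named
fact, no instance, no sorry (net debt 0). Sequel of `PairedTorsionModulesDVR.lean` (the structure
`N ≅ (R/ϖᵏ)^ε ⊕ M ⊕ M` from even layers); uses the tree's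
`Literature.GroupTheory.FiniteAbelian.even_finrank_of_isAlt_of_nondegenerate` (a non-degenerate
alternating form on a finite-dimensional vector space has even dimension) by name.

## Sources, verbatim (B. Howard, *The Heegner point Kolyvagin system*, Compositio Math. 140 (2004);
arXiv:1202.6340, held text `paper:arxiv-1202.6340`)

Proof of Thm. 1.4.2 (p0008 L132–L139): "We define a pairing `⟨ , ⟩ : V_s × V_s → R[𝔪]` by
`⟨a, b⟩ = (a, π^{s-1}b)_{s,1}`. The kernel on the right is `V_{s-1}`. If we can show that this pairing is
alternating, then `V_s/V_{s-1}` is even dimensional for every `1 ≤ s < k`, and the claim follows."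

§1.5 (p0010 L50–L75): "By Theorem 1.4.2 … for each `n ∈ 𝒩` there is an `R`-module `M(n)` and an integer
`ε` such that `𝓗(n) ≅ R^ε ⊕ M(n) ⊕ M(n)`. By the structure theorem for finitely-generated modules over
`R`, we can (and do) take `ε ∈ {0,1}`. It will be seen momentarily that `ε` is independent of `n`. …
**Proposition 1.5.5.** The integer `ε` appearing in the decomposition is congruent to `ρ(n) (mod 2)`
and is therefore independent of `n ∈ 𝒩` by Lemma 1.5.3. *Proof.* We have
`ε + 2 dim_{R/𝔪} M(n)[𝔪] = dim_{R/𝔪} 𝓗(n)[𝔪] = ρ(n)`, the second equality by Lemma 1.3.3."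
And in the proof of Thm. 1.6.1 (p0011 L41–L46): "we have a decomposition
`H¹_{𝓕(n)}(K, T^{(k)}) ≅ R^{(k),ε} ⊕ M^{(k)}(n) ⊕ M^{(k)}(n)` in which `ε ∈ {0,1}` is independent of both
`n` and `k`."

## What is proved (theorems only; `R` a DVR with uniformiser `ϖ` unless stated)

* §5 `even_length_quotient_of_isAlt_of_ker_eq` (`X` f.g., `ϖX ⊆ K ≤ X`, `B` alternating on `X` with values
  in a module whose `ϖ`-torsion is cyclic and left kernel exactly `K` ⟹ `ℓ_R(X/K)` even);
  **`even_length_torsionLayer_of_isAlt`** (the case `X = N[ϖˢ]`, `K = N[ϖ^{s-1}] + ϖN[ϖ^{s+1}]`);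
  **`exists_linearEquiv_pi_prod_pi_prod_self_of_isAlt`** (+ `…_pi_maximalIdeal_pow_…`) — THM. 1.4.2,
  ALGEBRAIC HALF IN PAIRING FORM: such pairings for all `1 ≤ s < k` on a f.g. `N` with `ϖᵏN = 0` give
  `N ≃ₗ[R] (Fin ε → R/(ϖᵏ)) × (M × M)`, `ε ≤ 1`, `M = Π_j R/(ϖ^{n_j})`, `1 ≤ n_j ≤ k`.
* §6 **`finrank_torsionBy_eq_of_linearEquiv_pi_prod_prod_self`** — PROP. 1.5.5's count
  `dim N[ϖ] = ε + 2·dim M[ϖ]` for `N ≅ C^ε × (M × M)`, `dim C[ϖ] = 1` (`C = R/𝔪ᵏ`, `k ≥ 1`);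
  **`eq_of_linearEquiv_pi_prod_prod_self_of_torsionBy_linearEquiv`** (two such decompositions with
  `ε, ε' ≤ 1` and `N[ϖ] ≅ N'[ϖ]` have `ε = ε'`) and `exists_uniform_epsilon_of_torsionBy_linearEquiv`
  (one `ε` for a tower of levels) — "`ε` is independent of both `n` and `k`" once the `𝔪`-torsions are
  identified (Lemma 1.3.3, not formalised here).
* §7 (`R` a PID) `exists_eq_smul_of_smul_eq_zero_quotient_uniformizer_pow`: `(R/ϖʲ)[ϖ]` is cyclic — the
  value-module hypothesis of §5 for Howard's `R^{(k)} = R/𝔪ᵏ`-valued pairings.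

Howard's Thm. 1.4.2 and Prop. 1.5.5 themselves (which need Prop. 1.4.1 = Flach's generalized Cassels–Tate
pairing, and Lemma 1.3.3) are NOT claimed; nothing here concerns Selmer groups.

## References

* [Howard2004HeegnerKolyvagin] B. Howard, *The Heegner point Kolyvagin system*, Compositio Math. 140
  (2004), no. 6, 1439–1472: Thm. 1.4.2 (proof), Def. 1.5.4, Prop. 1.5.5, proof of Thm. 1.6.1
  (arXiv:1202.6340 Thm. 2.4.2 p. 8; Prop. 2.5.5 p. 10; p. 11).
* [Hungerford1974] T. W. Hungerford, *Algebra*, GTM 73 (1974), Ch. IV Lemma 6.10 (iii) (PDF p. 305):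
  `(R/(pⁿ))[p] ≅ R/(p)`.
-/

open Module Submodule
open scoped Pointwise

namespace Literature.Algebra.Module

section Pairing

variable {R : Type*} [CommRing R] [IsDomain R] [IsDiscreteValuationRing R] {ϖ : R}
variable {N : Type*} [AddCommGroup N] [Module R N]

/-! ### §5 How the pairing enters: an alternating form with kernel `K` on a module `X` with `ϖX ⊆ K`
makes `X/K` even -/

/-- **Even length from an alternating form.** Let `X` be a finitely generated module over a DVR `R`
with uniformiser `ϖ`, `K ≤ X` a submodule containing `ϖX`, and `B` an `R`-bilinear ALTERNATING form
on `X` with values in an `R`-module `P` whose `ϖ`-torsion is cyclic (e.g. `P = R/(ϖʲ)`,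
`exists_eq_smul_of_smul_eq_zero_quotient_uniformizer_pow`), whose (left) kernel is EXACTLY `K`. Then
`X/K` has even length: `B` descends to a non-degenerate alternating form on the `R/(ϖ)`-vector space
`X/K` (the tree's `even_finrank_of_isAlt_of_nondegenerate`). [cite: Howard2004HeegnerKolyvagin, Thm. 1.4.2 (proof) = arXiv:1202.6340 Thm. 2.4.2, p0008 L132–L139] -/
theorem even_length_quotient_of_isAlt_of_ker_eq (hϖ : Irreducible ϖ) {X : Type*} [AddCommGroup X]
    [Module R X] [Module.Finite R X] (K : Submodule R X) (hK : ∀ x : X, ϖ • x ∈ K)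
    {P : Type*} [AddCommGroup P] [Module R P]
    (hP : ∀ p q : P, ϖ • p = 0 → ϖ • q = 0 → p ≠ 0 → ∃ r : R, q = r • p)
    (B : X →ₗ[R] X →ₗ[R] P) (halt : ∀ x, B x x = 0) (hker : ∀ x, (∀ y, B x y = 0) ↔ x ∈ K) :
    Even (Module.length R (X ⧸ K)) := by
  classical
  haveI : Ideal.IsMaximal (R ∙ ϖ) := PrincipalIdealRing.isMaximal_of_irreducible hϖ
  letI : Field (R ⧸ R ∙ ϖ) := Ideal.Quotient.field (R ∙ ϖ)
  -- skew-symmetry and the two-sided kernel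
  have hskew : ∀ x y, B x y = -B y x := fun x y ↦ by
    have h := halt (x + y)
    simp only [map_add, LinearMap.add_apply, halt, zero_add, add_zero] at h
    exact eq_neg_of_add_eq_zero_right h
  have hKl : ∀ x ∈ K, ∀ y, B x y = 0 := fun x hx y ↦ (hker x).2 hx y
  have hKr : ∀ y ∈ K, ∀ x, B x y = 0 := fun y hy x ↦ by rw [hskew, hKl y hy x, neg_zero]
  -- descend `B` to `Q = X/K`
  have hB₁ : K ≤ LinearMap.ker B := fun x hx ↦ by
    rw [LinearMap.mem_ker]
    ext y
    exact hKl x hx y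
  let B₁ : (X ⧸ K) →ₗ[R] X →ₗ[R] P := K.liftQ B hB₁
  have hB₁apply : ∀ x y, B₁ (Submodule.Quotient.mk x) y = B x y := fun x y ↦ rfl
  have hB₂ : K ≤ LinearMap.ker B₁.flip := fun y hy ↦ by
    rw [LinearMap.mem_ker]
    ext x
    simpa only [LinearMap.coe_comp, Function.comp_apply, Submodule.mkQ_apply, LinearMap.flip_apply,
      hB₁apply, LinearMap.zero_comp, LinearMap.zero_apply] using hKr y hy x
  let B₂ : (X ⧸ K) →ₗ[R] (X ⧸ K) →ₗ[R] P := K.liftQ B₁.flip hB₂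
  have hB₂apply : ∀ x y, B₂ (Submodule.Quotient.mk y) (Submodule.Quotient.mk x) = B x y :=
    fun x y ↦ rfl
  -- `Q` is killed by `ϖ`
  have hQ : ∀ q : X ⧸ K, ϖ • q = 0 := by
    intro q
    induction q using Submodule.Quotient.induction_on with
    | H x => rw [← Submodule.Quotient.mk_smul, Submodule.Quotient.mk_eq_zero]; exact hK x
  have htop : torsionBy R (X ⧸ K) ϖ = ⊤ :=
    eq_top_iff.2 fun q _ ↦ (mem_torsionBy_iff _ _).2 (hQ q)
  -- values of `B₂` are `ϖ`-torsion
  have hval : ∀ v w : X ⧸ K, B₂ v w ∈ torsionBy R P ϖ := fun v w ↦ by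
    rw [mem_torsionBy_iff, ← LinearMap.smul_apply, ← map_smul, hQ v, map_zero, LinearMap.zero_apply]
  -- an injective `R/(ϖ)`-linear functional on `P[ϖ]`
  obtain ⟨ιP, hιP⟩ :
      ∃ ιP : ↥(torsionBy R P ϖ) →ₗ[R ⧸ R ∙ ϖ] (R ⧸ R ∙ ϖ), Function.Injective ιP := by
    by_cases h0 : ∃ p : ↥(torsionBy R P ϖ), p ≠ 0
    · obtain ⟨p₀, hp₀⟩ := h0
      have hspan : (R ⧸ R ∙ ϖ) ∙ p₀ = ⊤ := by
        refine eq_top_iff.2 fun q _ ↦ ?_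
        obtain ⟨r, hr⟩ := hP p₀ q ((mem_torsionBy_iff _ _).1 p₀.2) ((mem_torsionBy_iff _ _).1 q.2)
          (fun h ↦ hp₀ (Subtype.ext h))
        rw [mem_span_singleton]
        exact ⟨Ideal.Quotient.mk (R ∙ ϖ) r, by rw [torsionBy.mk_smul]; exact Subtype.ext hr.symm⟩
      exact ⟨((LinearEquiv.ofTop _ hspan).symm.trans
          (LinearEquiv.toSpanNonzeroSingleton (R ⧸ R ∙ ϖ) _ p₀ hp₀).symm).toLinearMap,
        LinearEquiv.injective _⟩
    · refine ⟨0, fun p q _ ↦ ?_⟩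
      simp only [not_exists, not_not] at h0
      rw [h0 p, h0 q]
  -- the induced `R/(ϖ)`-bilinear form on `V = Q[ϖ] = Q`
  let B₃ : LinearMap.BilinForm (R ⧸ R ∙ ϖ) ↥(torsionBy R (X ⧸ K) ϖ) :=
    LinearMap.mk₂ (R ⧸ R ∙ ϖ)
      (fun v w : ↥(torsionBy R (X ⧸ K) ϖ) ↦ ιP ⟨B₂ (v : X ⧸ K) (w : X ⧸ K), hval _ _⟩)
      (fun v₁ v₂ w ↦ by
        rw [← map_add]
        congr 1
        exact Subtype.ext (by simp only [map_add, LinearMap.add_apply, AddMemClass.coe_add]))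
      (fun c v w ↦ by
        obtain ⟨r, rfl⟩ := Ideal.Quotient.mk_surjective c
        rw [← map_smul]
        congr 1
        refine Subtype.ext ?_
        simp only [torsionBy.mk_smul, SetLike.val_smul]
        rw [map_smul, LinearMap.smul_apply])
      (fun v w₁ w₂ ↦ by
        rw [← map_add]
        congr 1
        exact Subtype.ext (by simp only [map_add, AddMemClass.coe_add]))
      (fun c v w ↦ by
        obtain ⟨r, rfl⟩ := Ideal.Quotient.mk_surjective c
        rw [← map_smul]
        congr 1
        refine Subtype.ext ?_
        simp only [torsionBy.mk_smul, SetLike.val_smul]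
        rw [map_smul])
  have hB₃apply : ∀ v w : ↥(torsionBy R (X ⧸ K) ϖ),
      B₃ v w = ιP ⟨B₂ (v : X ⧸ K) (w : X ⧸ K), hval _ _⟩ := fun v w ↦ rfl
  have hB₃zero : ∀ v w : ↥(torsionBy R (X ⧸ K) ϖ),
      B₃ v w = 0 ↔ B₂ (v : X ⧸ K) (w : X ⧸ K) = 0 := fun v w ↦ by
    rw [hB₃apply, ← map_zero ιP, hιP.eq_iff, Subtype.ext_iff]
    rfl
  have halt₃ : B₃.IsAlt := by
    intro v
    rw [hB₃zero]
    obtain ⟨x, hx⟩ := Submodule.Quotient.mk_surjective K (v : X ⧸ K)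
    rw [← hx, hB₂apply]
    exact halt x
  -- non-degeneracy: a class orthogonal to everything lies in `K`
  have hsep : ∀ v : ↥(torsionBy R (X ⧸ K) ϖ), (∀ w : ↥(torsionBy R (X ⧸ K) ϖ), B₃ v w = 0) →
      v = 0 := by
    intro v hv
    obtain ⟨y, hy⟩ := Submodule.Quotient.mk_surjective K (v : X ⧸ K)
    have hyK : y ∈ K := by
      refine (hker y).1 fun x ↦ ?_
      have h := hv ⟨Submodule.Quotient.mk x, by rw [htop]; exact mem_top⟩
      rw [hB₃zero] at h
      change B₂ (v : X ⧸ K) (Submodule.Quotient.mk x) = 0 at h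
      rw [← hy, hB₂apply] at h
      rw [hskew, h, neg_zero]
    exact Subtype.ext (by rw [← hy]; exact (Submodule.Quotient.mk_eq_zero K).2 hyK)
  have hnd₃ : B₃.Nondegenerate := by
    refine ⟨fun v hv ↦ hsep v hv, fun w hw ↦ hsep w fun v ↦ ?_⟩
    have h := hw v
    rw [hB₃zero] at h ⊢
    obtain ⟨x, hx⟩ := Submodule.Quotient.mk_surjective K (v : X ⧸ K)
    obtain ⟨y, hy⟩ := Submodule.Quotient.mk_surjective K (w : X ⧸ K)
    rw [← hx, ← hy, hB₂apply] at h ⊢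
    rw [hskew, h, neg_zero]
  -- finiteness and the dimension count
  haveI : Module.Finite (R ⧸ R ∙ ϖ) ↥(torsionBy R (X ⧸ K) ϖ) := finite_torsionBy ϖ
  obtain ⟨r, hr⟩ :=
    Literature.GroupTheory.FiniteAbelian.even_finrank_of_isAlt_of_nondegenerate halt₃ hnd₃
  have hlen : Module.length R (X ⧸ K) = Module.finrank (R ⧸ R ∙ ϖ) ↥(torsionBy R (X ⧸ K) ϖ) := by
    rw [← (LinearEquiv.ofTop _ htop).length_eq, Module.length_eq_of_surjective (S := R)
      (R := R ⧸ R ∙ ϖ) (M := ↥(torsionBy R (X ⧸ K) ϖ)) Ideal.Quotient.mk_surjective,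
      Module.length_eq_finrank]
  rw [hlen, hr]
  exact ⟨r, by push_cast; rfl⟩

/-- **The pairing entry of Howard's Thm. 1.4.2.** An `R`-bilinear ALTERNATING form `B` on
`N[ϖ^{t+1}]` with values in a module whose `ϖ`-torsion is cyclic and with (left) kernel EXACTLY
`N[ϖᵗ] + ϖ·N[ϖ^{t+2}]` (Howard: "We define a pairing `⟨ , ⟩ : V_s × V_s → R[𝔪]` by
`⟨a, b⟩ = (a, π^{s-1}b)_{s,1}`. The kernel on the right is `V_{s-1}`. If we can show that this pairing is
alternating, then `V_s/V_{s-1}` is even dimensional") makes the layer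
`N[ϖ^{t+1}]/(N[ϖᵗ] + ϖN[ϖ^{t+2}])` of even length.
[cite: Howard2004HeegnerKolyvagin, Thm. 1.4.2 (proof) = arXiv:1202.6340 Thm. 2.4.2, p0008 L132–L139] -/
theorem even_length_torsionLayer_of_isAlt (hϖ : Irreducible ϖ) [Module.Finite R N] (t : ℕ)
    {P : Type*} [AddCommGroup P] [Module R P]
    (hP : ∀ p q : P, ϖ • p = 0 → ϖ • q = 0 → p ≠ 0 → ∃ r : R, q = r • p)
    (B : ↥(torsionBy R N (ϖ ^ (t + 1))) →ₗ[R] ↥(torsionBy R N (ϖ ^ (t + 1))) →ₗ[R] P)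
    (halt : ∀ x, B x x = 0)
    (hker : ∀ x, (∀ y, B x y = 0) ↔
      (x : N) ∈ torsionBy R N (ϖ ^ t) ⊔ ϖ • torsionBy R N (ϖ ^ (t + 2))) :
    Even (Module.length R
      ((↥(torsionBy R N (ϖ ^ (t + 1))) ⧸ comap (torsionBy R N (ϖ ^ (t + 1))).subtype
        (torsionBy R N (ϖ ^ t) ⊔ ϖ • torsionBy R N (ϖ ^ (t + 2)))))) := by
  haveI : IsNoetherian R N := isNoetherian_of_isNoetherianRing_of_finite R N
  refine even_length_quotient_of_isAlt_of_ker_eq hϖ _ (fun x ↦ ?_) hP B halt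
    (fun x ↦ (hker x).trans Iff.rfl)
  rw [mem_comap, Submodule.subtype_apply, SetLike.val_smul]
  exact mem_sup_right (smul_mem_pointwise_smul _ _ _
    (torsionBy_le_torsionBy_of_dvd _ _ (pow_dvd_pow ϖ (Nat.le_succ _)) x.2))

/-- **HOWARD 2004, THM. 1.4.2 — algebraic half, pairing form.** `N` finitely generated over a DVR, killed
by `ϖᵏ`; for each `1 ≤ s < k` an alternating `R`-bilinear form on `N[ϖˢ]`, with values in a module whose
`ϖ`-torsion is cyclic and with kernel exactly `N[ϖ^{s-1}] + ϖN[ϖ^{s+1}]`. Then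
`N ≅ (R/ϖᵏ)^ε ⊕ M ⊕ M`, `ε ≤ 1`, `M = Π_j R/(ϖ^{n_j})` with `1 ≤ n_j ≤ k`.
[cite: Howard2004HeegnerKolyvagin, Thm. 1.4.2 = arXiv:1202.6340 Thm. 2.4.2, p0008 L100–L139] -/
theorem exists_linearEquiv_pi_prod_pi_prod_self_of_isAlt (hϖ : Irreducible ϖ) [Module.Finite R N]
    {k : ℕ} (hk : ∀ x : N, ϖ ^ k • x = 0)
    {P : ℕ → Type*} [∀ t, AddCommGroup (P t)] [∀ t, Module R (P t)]
    (hP : ∀ t, ∀ p q : P t, ϖ • p = 0 → ϖ • q = 0 → p ≠ 0 → ∃ r : R, q = r • p)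
    (B : ∀ t, ↥(torsionBy R N (ϖ ^ (t + 1))) →ₗ[R] ↥(torsionBy R N (ϖ ^ (t + 1))) →ₗ[R] P t)
    (halt : ∀ t, t + 1 < k → ∀ x, B t x x = 0)
    (hker : ∀ t, t + 1 < k → ∀ x, (∀ y, B t x y = 0) ↔
      (x : N) ∈ torsionBy R N (ϖ ^ t) ⊔ ϖ • torsionBy R N (ϖ ^ (t + 2))) :
    ∃ (ε m : ℕ) (n : Fin m → ℕ), ε ≤ 1 ∧ (∀ j, 1 ≤ n j ∧ n j ≤ k) ∧
      Nonempty (N ≃ₗ[R] (Fin ε → R ⧸ Ideal.span {ϖ ^ k}) ×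
        ((Π j, R ⧸ Ideal.span {ϖ ^ n j}) × (Π j, R ⧸ Ideal.span {ϖ ^ n j}))) :=
  exists_linearEquiv_pi_prod_pi_prod_self_of_even_length_torsionLayer hϖ hk fun t ht ↦
    even_length_torsionLayer_of_isAlt hϖ t (hP t) (B t) (halt t ht) (hker t ht)

/-- The same decomposition with the free part written over `R/𝔪ᵏ`, `𝔪 = (ϖ)` the maximal ideal (the shape
`(Fin ε → R ⧸ 𝔪^{e_k}) × (M_k × M_k)` in which the tree's `DVRSetting` files consume Howard's levelwise
structure). [cite: Howard2004HeegnerKolyvagin, Thm. 1.4.2 = arXiv:1202.6340 Thm. 2.4.2, p0008 L100–L139; Thm. 1.6.1 (proof), p0011 L41–L46] -/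
theorem exists_linearEquiv_pi_maximalIdeal_pow_prod_pi_prod_self_of_isAlt (hϖ : Irreducible ϖ)
    [Module.Finite R N] {k : ℕ} (hk : ∀ x : N, ϖ ^ k • x = 0)
    {P : ℕ → Type*} [∀ t, AddCommGroup (P t)] [∀ t, Module R (P t)]
    (hP : ∀ t, ∀ p q : P t, ϖ • p = 0 → ϖ • q = 0 → p ≠ 0 → ∃ r : R, q = r • p)
    (B : ∀ t, ↥(torsionBy R N (ϖ ^ (t + 1))) →ₗ[R] ↥(torsionBy R N (ϖ ^ (t + 1))) →ₗ[R] P t)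
    (halt : ∀ t, t + 1 < k → ∀ x, B t x x = 0)
    (hker : ∀ t, t + 1 < k → ∀ x, (∀ y, B t x y = 0) ↔
      (x : N) ∈ torsionBy R N (ϖ ^ t) ⊔ ϖ • torsionBy R N (ϖ ^ (t + 2))) :
    ∃ (ε m : ℕ) (n : Fin m → ℕ), ε ≤ 1 ∧ (∀ j, 1 ≤ n j ∧ n j ≤ k) ∧
      Nonempty (N ≃ₗ[R] (Fin ε → R ⧸ IsLocalRing.maximalIdeal R ^ k) ×
        ((Π j, R ⧸ Ideal.span {ϖ ^ n j}) × (Π j, R ⧸ Ideal.span {ϖ ^ n j}))) := by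
  obtain ⟨ε, m, n, hε, hn, ⟨e⟩⟩ := exists_linearEquiv_pi_prod_pi_prod_self_of_isAlt hϖ hk hP B halt hker
  have hmax : Ideal.span {ϖ ^ k} = IsLocalRing.maximalIdeal R ^ k := by
    rw [(IsDiscreteValuationRing.irreducible_iff_uniformizer ϖ).mp hϖ, Ideal.span_singleton_pow]
  exact ⟨ε, m, n, hε, hn, ⟨e.trans ((LinearEquiv.piCongrRight fun _ : Fin ε ↦
    Submodule.quotEquivOfEq _ _ hmax).prodCongr (LinearEquiv.refl R _))⟩⟩

end Pairing

/-! ### §6 `ε ≡ dim N[ϖ] (mod 2)` (Howard 2004, Prop. 1.5.5) -/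

section Parity

variable {R : Type*} [CommRing R] [IsDomain R] [IsDiscreteValuationRing R] {ϖ : R}
variable {N : Type*} [AddCommGroup N] [Module R N]

/-- `dim_{R/(ϖ)} (R/ϖ^{j+1})[ϖ] = 1` ("`(R/(pⁿ))[p] ≅ R/(p)`"). [cite: Hungerford1974, Ch. IV Lemma 6.10 (iii) (PDF p. 305)] -/
theorem finrank_torsionBy_quotient_uniformizer_pow_succ (hϖ : Irreducible ϖ) (j : ℕ) :
    Module.finrank (R ⧸ R ∙ ϖ) ↥(torsionBy R (R ⧸ Ideal.span {ϖ ^ (j + 1)}) ϖ) = 1 := by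
  have h := finrank_torsionBy_quotient_prime_mul hϖ.prime (c := ϖ ^ j) (pow_ne_zero _ hϖ.ne_zero)
  rwa [← pow_succ'] at h

/-- `dim_{R/(ϖ)} (R/𝔪ᵏ)[ϖ] = 1` for `k ≥ 1`, `𝔪 = (ϖ)` the maximal ideal of the DVR `R`.
[cite: Hungerford1974, Ch. IV Lemma 6.10 (iii) (PDF p. 305)] -/
theorem finrank_torsionBy_quotient_maximalIdeal_pow (hϖ : Irreducible ϖ) {k : ℕ} (hk : 1 ≤ k) :
    Module.finrank (R ⧸ R ∙ ϖ) ↥(torsionBy R (R ⧸ IsLocalRing.maximalIdeal R ^ k) ϖ) = 1 := by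
  obtain ⟨j, rfl⟩ : ∃ j, k = j + 1 := ⟨k - 1, by omega⟩
  have hmax : IsLocalRing.maximalIdeal R ^ (j + 1) = Ideal.span {ϖ ^ (j + 1)} := by
    rw [(IsDiscreteValuationRing.irreducible_iff_uniformizer ϖ).mp hϖ, Ideal.span_singleton_pow]
  rw [finrank_torsionBy_eq_of_linearEquiv (Submodule.quotEquivOfEq _ _ hmax) ϖ]
  exact finrank_torsionBy_quotient_uniformizer_pow_succ hϖ j

/-- **HOWARD 2004, PROP. 1.5.5 — the count `ε + 2·dim M[𝔪] = dim 𝓗[𝔪]`.** If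
`N ≅ C^ε × (M × M)` with `dim_{R/(ϖ)} C[ϖ] = 1` (e.g. `C = R/ϖᵏ = R/𝔪ᵏ`, `k ≥ 1`:
`finrank_torsionBy_quotient_uniformizer_pow_succ`, `finrank_torsionBy_quotient_maximalIdeal_pow`), then
`dim_{R/(ϖ)} N[ϖ] = ε + 2·dim_{R/(ϖ)} M[ϖ]`; in particular `ε ≡ dim N[ϖ] (mod 2)` ("We have
`ε + 2 dim_{R/𝔪} M(n)[𝔪] = dim_{R/𝔪} 𝓗(n)[𝔪] = ρ(n)`").
[cite: Howard2004HeegnerKolyvagin, Prop. 1.5.5 = arXiv:1202.6340 Prop. 2.5.5, p0010 L67–L75] -/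
theorem finrank_torsionBy_eq_of_linearEquiv_pi_prod_prod_self (hϖ : Irreducible ϖ) {ε : ℕ}
    {C : Type*} [AddCommGroup C] [Module R C] [Module.Finite R C]
    (hC : Module.finrank (R ⧸ R ∙ ϖ) ↥(torsionBy R C ϖ) = 1)
    {M : Type*} [AddCommGroup M] [Module R M] [Module.Finite R M]
    (e : N ≃ₗ[R] (Fin ε → C) × (M × M)) :
    Module.finrank (R ⧸ R ∙ ϖ) ↥(torsionBy R N ϖ) =
      ε + 2 * Module.finrank (R ⧸ R ∙ ϖ) ↥(torsionBy R M ϖ) := by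
  have hp : Prime ϖ := hϖ.prime
  haveI : Module.Finite R N := Module.Finite.equiv e.symm
  rw [finrank_torsionBy_eq_of_linearEquiv e ϖ, finrank_torsionBy_prod hp, finrank_torsionBy_prod hp,
    finrank_torsionBy_pi hp, Finset.sum_const, Finset.card_univ, Fintype.card_fin, hC, smul_eq_mul,
    mul_one, two_mul]

/-- The same count in lengths: `ℓ_R(N[ϖ]) = ε + 2·dim_{R/(ϖ)} M[ϖ]`.
[cite: Howard2004HeegnerKolyvagin, Prop. 1.5.5 = arXiv:1202.6340 Prop. 2.5.5, p0010 L67–L75] -/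
theorem length_torsionBy_eq_of_linearEquiv_pi_prod_prod_self (hϖ : Irreducible ϖ) {ε : ℕ}
    {C : Type*} [AddCommGroup C] [Module R C] [Module.Finite R C]
    (hC : Module.finrank (R ⧸ R ∙ ϖ) ↥(torsionBy R C ϖ) = 1)
    {M : Type*} [AddCommGroup M] [Module R M] [Module.Finite R M]
    (e : N ≃ₗ[R] (Fin ε → C) × (M × M)) :
    Module.length R ↥(torsionBy R N ϖ) =
      ((ε + 2 * Module.finrank (R ⧸ R ∙ ϖ) ↥(torsionBy R M ϖ) : ℕ) : ℕ∞) := by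
  haveI : Ideal.IsMaximal (R ∙ ϖ) := PrincipalIdealRing.isMaximal_of_irreducible hϖ
  letI : Field (R ⧸ R ∙ ϖ) := Ideal.Quotient.field (R ∙ ϖ)
  haveI : Module.Finite R N := Module.Finite.equiv e.symm
  haveI : Module.Finite (R ⧸ R ∙ ϖ) ↥(torsionBy R N ϖ) := finite_torsionBy ϖ
  rw [← finrank_torsionBy_eq_of_linearEquiv_pi_prod_prod_self hϖ hC e,
    Module.length_eq_of_surjective (S := R) (R := R ⧸ R ∙ ϖ) (M := ↥(torsionBy R N ϖ))
      Ideal.Quotient.mk_surjective, Module.length_eq_finrank]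

/-- **HOWARD 2004, PROP. 1.5.5 — `ε` is determined by `N[ϖ]`.** Two modules decomposed as
`N ≅ C^ε × (M × M)` and `N' ≅ C'^{ε'} × (M' × M')` with `ε, ε' ≤ 1`, `dim C[ϖ] = dim C'[ϖ] = 1` (e.g.
`C = R/𝔪ᵏ`, `C' = R/𝔪^{k'}`, `k, k' ≥ 1`) and ISOMORPHIC `ϖ`-torsion `N[ϖ] ≅ N'[ϖ]` have `ε = ε'` ("The
integer `ε` … is congruent to `ρ(n) (mod 2)` and is therefore independent of `n`"; across the levels
`k` of `H¹_𝓕(K, T/𝔪ᵏT)` the common `𝔪`-torsion is `H¹_𝓕(K, T̄)` by Lemma 1.3.3, whence "`ε ∈ {0,1}` is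
independent of both `n` and `k`", p0011 L44–L46).
[cite: Howard2004HeegnerKolyvagin, Prop. 1.5.5 = arXiv:1202.6340 Prop. 2.5.5, p0010 L67–L75; Thm. 1.6.1 (proof) = Thm. 2.6.1, p0011 L41–L46] -/
theorem eq_of_linearEquiv_pi_prod_prod_self_of_torsionBy_linearEquiv (hϖ : Irreducible ϖ)
    {N' : Type*} [AddCommGroup N'] [Module R N'] {ε ε' : ℕ} (hε : ε ≤ 1) (hε' : ε' ≤ 1)
    {C : Type*} [AddCommGroup C] [Module R C] [Module.Finite R C]
    (hC : Module.finrank (R ⧸ R ∙ ϖ) ↥(torsionBy R C ϖ) = 1)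
    {C' : Type*} [AddCommGroup C'] [Module R C'] [Module.Finite R C']
    (hC' : Module.finrank (R ⧸ R ∙ ϖ) ↥(torsionBy R C' ϖ) = 1)
    {M : Type*} [AddCommGroup M] [Module R M] [Module.Finite R M]
    {M' : Type*} [AddCommGroup M'] [Module R M'] [Module.Finite R M']
    (e : N ≃ₗ[R] (Fin ε → C) × (M × M)) (e' : N' ≃ₗ[R] (Fin ε' → C') × (M' × M'))
    (f : ↥(torsionBy R N ϖ) ≃ₗ[R] ↥(torsionBy R N' ϖ)) : ε = ε' := by
  have h := f.length_eq
  rw [length_torsionBy_eq_of_linearEquiv_pi_prod_prod_self hϖ hC e,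
    length_torsionBy_eq_of_linearEquiv_pi_prod_prod_self hϖ hC' e', Nat.cast_inj] at h
  omega

/-- **One `ε` for a whole tower of levels.** Given decompositions `N_k ≅ C_k^{ε_k} × (M_k × M_k)` with
`ε_k ≤ 1`, `dim C_k[ϖ] = 1`, and identifications of all the `ϖ`-torsions `N_k[ϖ] ≅ N_0[ϖ]` (for Howard's
levels `H¹_𝓕(K, T/𝔪^{e_k}T)`: all `≅ H¹_𝓕(K, T̄)` by Lemma 1.3.3), there is a single `ε ≤ 1` with
`N_k ≅ C_k^ε × (M_k × M_k)` for every `k` — "`ε ∈ {0,1}` is independent of both `n` and `k`".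
[cite: Howard2004HeegnerKolyvagin, Thm. 1.6.1 (proof) = arXiv:1202.6340 Thm. 2.6.1, p0011 L41–L46; Prop. 1.5.5 = Prop. 2.5.5, p0010 L67–L75] -/
theorem exists_uniform_epsilon_of_torsionBy_linearEquiv (hϖ : Irreducible ϖ)
    {L : ℕ → Type*} [∀ k, AddCommGroup (L k)] [∀ k, Module R (L k)] {ε : ℕ → ℕ} (hε : ∀ k, ε k ≤ 1)
    {C : ℕ → Type*} [∀ k, AddCommGroup (C k)] [∀ k, Module R (C k)] [∀ k, Module.Finite R (C k)]
    (hC : ∀ k, Module.finrank (R ⧸ R ∙ ϖ) ↥(torsionBy R (C k) ϖ) = 1)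
    {M : ℕ → Type*} [∀ k, AddCommGroup (M k)] [∀ k, Module R (M k)] [∀ k, Module.Finite R (M k)]
    (θ : ∀ k, L k ≃ₗ[R] (Fin (ε k) → C k) × (M k × M k))
    (f : ∀ k, ↥(torsionBy R (L k) ϖ) ≃ₗ[R] ↥(torsionBy R (L 0) ϖ)) :
    ∃ ε₀ : ℕ, ε₀ ≤ 1 ∧ ∀ k, Nonempty (L k ≃ₗ[R] (Fin ε₀ → C k) × (M k × M k)) := by
  refine ⟨ε 0, hε 0, fun k ↦ ?_⟩
  have hk : ε k = ε 0 := eq_of_linearEquiv_pi_prod_prod_self_of_torsionBy_linearEquiv hϖ (hε k) (hε 0)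
    (hC k) (hC 0) (θ k) (θ 0) (f k)
  exact ⟨(θ k).trans ((LinearEquiv.funCongrLeft R (C k) (finCongr hk.symm)).prodCongr
    (LinearEquiv.refl R _))⟩

end Parity

/-! ### §7 Discharging the value-module hypothesis: `(R/ϖʲ)[ϖ]` is cyclic -/

section Values

variable {R : Type*} [CommRing R] [IsDomain R] [IsPrincipalIdealRing R] {ϖ : R}

/-- In `R/(ϖʲ)` (`ϖ` irreducible, `R` a PID) every `ϖ`-torsion element is a multiple of any given
non-zero `ϖ`-torsion element: the `ϖ`-torsion `ϖ^{j-1}R/ϖʲR ≅ R/(ϖ)` is a line over the residue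
field. This discharges the hypothesis `hP` of `even_length_torsionLayer_of_isAlt` for the value modules
`R^{(k)} = R/𝔪ᵏ` of Howard's pairings `( , )_{s,t}` ("`(R/(pⁿ))[p]` is generated […] by the single nonzero
element `p^{n-1} + (pⁿ)`"). [cite: Hungerford1974, Ch. IV Lemma 6.10 (iii) (PDF p. 305)] -/
theorem exists_eq_smul_of_smul_eq_zero_quotient_uniformizer_pow (hϖ : Irreducible ϖ) (j : ℕ)
    (p q : R ⧸ Ideal.span {ϖ ^ j}) (hp : ϖ • p = 0) (hq : ϖ • q = 0) (hp0 : p ≠ 0) :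
    ∃ r : R, q = r • p := by
  cases j with
  | zero =>
    exfalso
    apply hp0
    have : Ideal.span {(ϖ ^ 0 : R)} = ⊤ := by rw [pow_zero, Ideal.span_singleton_one]
    haveI : Subsingleton (R ⧸ Ideal.span {ϖ ^ 0}) := Ideal.Quotient.subsingleton_iff.2 this
    exact Subsingleton.elim _ _
  | succ j =>
    haveI : Ideal.IsMaximal (R ∙ ϖ) := PrincipalIdealRing.isMaximal_of_irreducible hϖ
    letI : Field (R ⧸ R ∙ ϖ) := Ideal.Quotient.field (R ∙ ϖ)
    obtain ⟨a, rfl⟩ := Ideal.Quotient.mk_surjective p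
    obtain ⟨b, rfl⟩ := Ideal.Quotient.mk_surjective q
    -- `ϖ a ∈ (ϖ^{j+1})` forces `a = ϖʲ a'`, and similarly for `b`
    have hdiv : ∀ c : R, ϖ • Ideal.Quotient.mk (Ideal.span {ϖ ^ (j + 1)}) c = 0 → ∃ c', c = ϖ ^ j * c' :=
      fun c hc ↦ by
        rw [Algebra.smul_def, Ideal.Quotient.algebraMap_eq, ← map_mul, Ideal.Quotient.eq_zero_iff_mem,
          Ideal.mem_span_singleton, pow_succ', mul_dvd_mul_iff_left hϖ.ne_zero] at hc
        exact hc
    obtain ⟨a', rfl⟩ := hdiv a hp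
    obtain ⟨b', rfl⟩ := hdiv b hq
    -- `p ≠ 0` means `ϖ ∤ a'`, so `a'` is invertible modulo `ϖ`
    have ha' : a' ∉ R ∙ ϖ := fun h ↦ hp0 (by
      rw [Ideal.Quotient.eq_zero_iff_mem, Ideal.mem_span_singleton, pow_succ]
      exact mul_dvd_mul_left _ (Ideal.mem_span_singleton.1 h))
    obtain ⟨y, i, hi, hyi⟩ := (‹Ideal.IsMaximal (R ∙ ϖ)›).exists_inv ha'
    obtain ⟨c, hc⟩ := Ideal.mem_span_singleton.1 hi
    refine ⟨b' * y, ?_⟩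
    rw [Algebra.smul_def, Ideal.Quotient.algebraMap_eq, ← map_mul, Ideal.Quotient.eq,
      Ideal.mem_span_singleton]
    refine ⟨b' * c, ?_⟩
    have h1 : (1 : R) - y * a' = i := by rw [← hyi]; ring
    calc ϖ ^ j * b' - b' * y * (ϖ ^ j * a') = ϖ ^ j * b' * (1 - y * a') := by ring
      _ = ϖ ^ j * b' * i := by rw [h1]
      _ = ϖ ^ (j + 1) * (b' * c) := by rw [hc]; ring

end Values

/-! ### §8 The levelwise package of a tower (appended): one `ε ≤ 1` and explicit `M_k` for all levels -/

section Tower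

variable {R : Type*} [CommRing R] [IsDomain R] [IsDiscreteValuationRing R] {ϖ : R}

/-- **THE LEVELWISE STRUCTURE PACKAGE OF HOWARD'S THM. 1.6.1, FROM LEVEL PAIRINGS.** Let `L_k`
(`k ∈ ℕ`) be finitely generated modules over a DVR `R` with uniformiser `ϖ`, `L_k` killed by `ϖ^{e_k}`,
`e_k ≥ 1`; suppose each `L_k` carries, for every `1 ≤ s < e_k`, an alternating `R`-bilinear form on
`L_k[ϖˢ]` with values in a module whose `ϖ`-torsion is cyclic and with kernel exactly
`L_k[ϖ^{s-1}] + ϖ·L_k[ϖ^{s+1}]` (Howard: Prop. 1.4.1 + Lemma 1.3.3 on `H¹_𝓕(K, T/𝔪^{e_k}T)`), and that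
the `ϖ`-torsions are identified, `L_k[ϖ] ≅ L_0[ϖ]` (Lemma 1.3.3: all are `H¹_𝓕(K, T̄)`). Then there are ONE
`ε ≤ 1` and explicit exponents `1 ≤ n_{k,j} ≤ e_k` with
`L_k ≅ (R/𝔪^{e_k})^ε × (M_k × M_k)`, `M_k = Π_j R/(ϖ^{n_{k,j}})`, for every `k` — the decomposition
"`H¹_{𝓕}(K, T^{(k)}) ≅ R^{(k),ε} ⊕ M^{(k)} ⊕ M^{(k)}` in which `ε ∈ {0,1}` is independent of `k`" that the
proof of Thm. 1.6.1 consumes (the tree's `DVRSetting.…_of_package` theorems take exactly this shape,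
with `M_k` finite when the residue field is).
[cite: Howard2004HeegnerKolyvagin, Thm. 1.6.1 (proof) = arXiv:1202.6340 Thm. 2.6.1, p0011 L39–L46; Thm. 1.4.2, Prop. 1.5.5] -/
theorem exists_levelwisePackage_of_isAlt (hϖ : Irreducible ϖ)
    {L : ℕ → Type*} [∀ k, AddCommGroup (L k)] [∀ k, Module R (L k)] [∀ k, Module.Finite R (L k)]
    {e : ℕ → ℕ} (he : ∀ k, 1 ≤ e k) (hkill : ∀ k (x : L k), ϖ ^ e k • x = 0)
    {P : ℕ → ℕ → Type*} [∀ k t, AddCommGroup (P k t)] [∀ k t, Module R (P k t)]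
    (hP : ∀ k t, ∀ p q : P k t, ϖ • p = 0 → ϖ • q = 0 → p ≠ 0 → ∃ r : R, q = r • p)
    (B : ∀ k t, ↥(torsionBy R (L k) (ϖ ^ (t + 1))) →ₗ[R] ↥(torsionBy R (L k) (ϖ ^ (t + 1))) →ₗ[R]
      P k t)
    (halt : ∀ k t, t + 1 < e k → ∀ x, B k t x x = 0)
    (hker : ∀ k t, t + 1 < e k → ∀ x, (∀ y, B k t x y = 0) ↔
      (x : L k) ∈ torsionBy R (L k) (ϖ ^ t) ⊔ ϖ • torsionBy R (L k) (ϖ ^ (t + 2)))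
    (f : ∀ k, ↥(torsionBy R (L k) ϖ) ≃ₗ[R] ↥(torsionBy R (L 0) ϖ)) :
    ∃ (ε : ℕ) (m : ℕ → ℕ) (n : ∀ k, Fin (m k) → ℕ), ε ≤ 1 ∧ (∀ k j, 1 ≤ n k j ∧ n k j ≤ e k) ∧
      ∀ k, Nonempty (L k ≃ₗ[R] (Fin ε → R ⧸ IsLocalRing.maximalIdeal R ^ e k) ×
        ((Π j, R ⧸ Ideal.span {ϖ ^ n k j}) × (Π j, R ⧸ Ideal.span {ϖ ^ n k j}))) := by
  have hlev := fun k ↦ exists_linearEquiv_pi_maximalIdeal_pow_prod_pi_prod_self_of_isAlt hϖ (hkill k)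
    (hP k) (B k) (halt k) (hker k)
  choose ε m n hε hn hθ using hlev
  have θ : ∀ k, L k ≃ₗ[R] (Fin (ε k) → R ⧸ IsLocalRing.maximalIdeal R ^ e k) ×
      ((Π j, R ⧸ Ideal.span {ϖ ^ n k j}) × (Π j, R ⧸ Ideal.span {ϖ ^ n k j})) :=
    fun k ↦ (hθ k).some
  obtain ⟨ε₀, hε₀, h⟩ := exists_uniform_epsilon_of_torsionBy_linearEquiv hϖ hε
    (C := fun k ↦ R ⧸ IsLocalRing.maximalIdeal R ^ e k)
    (fun k ↦ finrank_torsionBy_quotient_maximalIdeal_pow hϖ (he k))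
    (M := fun k ↦ Π j, R ⧸ Ideal.span {ϖ ^ n k j}) θ f
  exact ⟨ε₀, m, n, hε₀, hn, h⟩

end Tower

end Literature.Algebra.Module
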